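import Summits.ResolutionOfSingularities.ResolutionOfSingularities.Theorems.SpreadCutLaw3
import HarnessLib

/-!
# SpreadCutLaw4 — decomp-res node «SpreadCut» (lens-2 g19), file 4/4 of `SpreadCutLaw`

Content VERBATIM from the decomp-res lens-2 g19 node `HOME/decomp-res-lens-2/g19/SpreadCut.lean` (pin b2959d31, 3
579 l; HOME = run/shared/lean/pub/decomp-res);
CRITIC-LEDGER row 155 (DECIDED-MOD-PORT +1); landing orders INBOX :540: l. 143–2878 are `CylinderCut` d60dded1
VERBATIM (landed as `CylinderCutClasses` · `CylinderCutCells` ·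
`MaxContactCutCylinderCut`) and are DELETED here with the landed modules imported instead (namespaces
`…Theorems.PinchCut` / `JetCut` / `PurityCut` / `SplitCut` / `CylinderCut`
opened; same short names, byte-identical bodies — never two copies); NEW = §Γ (l. 2880–3336, the ring-level law +
§Γ.3 point level) and §V (l. 3338–3576, the spread cut).
Namespace `…Theorems.SpreadCut` (the lens's `Theses.SpreadCut` is gate-reserved), sub-namespace `Spread` as in the
lens; file split only (tree files ≤ 400 lines): sections,
variables, the `open MvPolynomial` lines and every declaration exactly as in the lens; the node's global
dupNamespace-linter line dropped.  Node files, in import order: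
`SpreadCutLaw` (§Γ + the cone-free head of §V; continued `…2` / `…3` where the cap cuts) · `SpreadCutCells` (§V2–§V4
cone-free: the aside home) · the wiring `MaxContactCutSpreadCut`
(§V BY NAME on the host route, in the Theses cone).  All `--supports stmt-ResolutionOfSingularities-29273`
(`MaxContactCut.RungOne`); nothing closes 29273 — decided halves
carry their engines as hypotheses (`SpreadExit` is a paper engine, not an item); exactly ONE located-residual aside
on the lens-2 column (`Spread.SpreadSpecialRung`, home
`SpreadCutCells`) SUPERSEDES g18's `Cyl.CylSpecialRung`, re-located EXACTLY modulo the spread decided half.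

§Γ (NEW, g19): LAW (Γ) — THE SECONDARY CURVE OF THE TOP CURVE read over `𝒪_C`, ring level: `binForm`, `lowerChart` /
`upperChart`, `RelSimple`, `SpreadShape` + kernels and the INSEP-v certificates (needs the tree's
`DeltaFaceCutClasses.qWeighted`); §Γ.3 point / curve level: `IsSpreadAt`, `IsUniformSpreadCurve`, the ENGINE `def
SpreadExit : Prop` (a paper engine: hypothesis, not an item), `IsSpreadCurvePt`, the decided class; and the
cone-free head of §V (`spreadLeaf = cylLeaf ∨ (Γ)` + order lemmas, the located residual class `IsSpreadSpecialPt` +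
iffs).  PROVED kernels, VERBATIM; continued `…2` where the 400-line cap cuts.

Part 4/4 carries: `isSpecPt_spreadLeaf_iff`, `isCylSpecialPt_of_isSpreadSpecialPt`,
`isSplitSpecialPt_of_isSpreadSpecialPt`, `isCylSpecialPt_iff`.

(Sources: Hironaka1964 Ch. III; CossartJannsenSaito2020 Ch. 2, Ch. 8–9; CossartPiltant2008 Prop. 4.2;
CossartPiltant2019 Rem. 3.2; BierstoneGrigorievMilmanWlodarczyk2011 §3.1; Moh1987; Hauser2010Kangaroo; Giraud1975;
Narasimhan1983.)
-/

open CategoryTheory AlgebraicGeometry TopologicalSpace IsLocalRing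
open Literature.AlgebraicGeometry.Resolution
open Summit.ResolutionOfSingularities.ResolutionOfSingularities.Theorems
open Summit.ResolutionOfSingularities.ResolutionOfSingularities.Theorems.WeakOrderReduction
open Summit.ResolutionOfSingularities.ResolutionOfSingularities.Theorems.DeltaFaceCutClasses
open Summit.ResolutionOfSingularities.ResolutionOfSingularities.Theorems.RelativeDeltaCut
open Summit.ResolutionOfSingularities.ResolutionOfSingularities.Theorems.CurveLeafExit
open Summit.ResolutionOfSingularities.ResolutionOfSingularities.Theorems.PinchCut
open Summit.ResolutionOfSingularities.ResolutionOfSingularities.Theorems.JetCut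
open Summit.ResolutionOfSingularities.ResolutionOfSingularities.Theorems.PurityCut
open Summit.ResolutionOfSingularities.ResolutionOfSingularities.Theorems.SplitCut
open Summit.ResolutionOfSingularities.ResolutionOfSingularities.Theorems.CylinderCut
open MvPolynomial

namespace Summit.ResolutionOfSingularities.ResolutionOfSingularities.Theorems.SpreadCut

/-- Pointwise: the spread-special class IS the `spreadLeaf`-special class of §G.  KERNEL (PROVED). [folklore] -/
theorem isSpecPt_spreadLeaf_iff {k : Type} [Field k] {Y : Scheme.{0}} (g : Y ⟶ Spec (.of k)) (hY : Scheme.IsRegular Y)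
    (I : Y.IdealSheafData) (n : ℕ) (y : Y) : Leaf.IsSpecPt spreadLeaf g hY I n y ↔ IsSpreadSpecialPt g hY I n y := by
  constructor
  · rintro ⟨hL, hno⟩
    exact ⟨(isSpecPt_cylLeaf_iff g hY I n y).mp ⟨hL, fun h => hno (Or.inl h)⟩, fun h => hno (Or.inr h)⟩
  · rintro ⟨hC, hΓ⟩
    obtain ⟨hL, hno⟩ := (isSpecPt_cylLeaf_iff g hY I n y).mpr hC
    refine ⟨hL, ?_⟩
    rintro (h | h)
    · exact hno h
    · exact hΓ h

/-- The spread-special class is contained in g18's cylinder-special class (the residual SHRINKS by letter).  KERNEL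
(PROVED). [folklore] -/
theorem isCylSpecialPt_of_isSpreadSpecialPt {k : Type} [Field k] {Y : Scheme.{0}} {g : Y ⟶ Spec (.of k)}
    {hY : Scheme.IsRegular Y} {I : Y.IdealSheafData} {n : ℕ} {y : Y} (h : IsSpreadSpecialPt g hY I n y) :
    IsCylSpecialPt g hY I n y :=
  h.1

/-- … and hence in g17's split-special class.  KERNEL (PROVED). [folklore] -/
theorem isSplitSpecialPt_of_isSpreadSpecialPt {k : Type} [Field k] {Y : Scheme.{0}} {g : Y ⟶ Spec (.of k)}
    {hY : Scheme.IsRegular Y} {I : Y.IdealSheafData} {n : ℕ} {y : Y} (h : IsSpreadSpecialPt g hY I n y) :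
    IsSplitSpecialPt g hY I n y :=
  h.1.1

/-- **EXACT POINTWISE DICHOTOMY of g18's residual class** (the structural dichotomy at a point): cylinder-special ⟺
(cylinder-special and
on a spread curve — the REGULAR secondary curve side, decided) ∨ spread-special (the SINGULAR secondary curve side).
 KERNEL (PROVED). [folklore] -/
theorem isCylSpecialPt_iff {k : Type} [Field k] {Y : Scheme.{0}} (g : Y ⟶ Spec (.of k)) (hY : Scheme.IsRegular Y)
    (I : Y.IdealSheafData) (n : ℕ) (y : Y) :
    IsCylSpecialPt g hY I n y ↔
      (IsCylSpecialPt g hY I n y ∧ IsSpreadCurvePt I n y) ∨ IsSpreadSpecialPt g hY I n y := by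
  constructor
  · intro h
    by_cases hc : IsSpreadCurvePt I n y
    · exact Or.inl ⟨h, hc⟩
    · exact Or.inr ⟨h, hc⟩
  · rintro (⟨h, _⟩ | ⟨h, _⟩) <;> exact h

end Summit.ResolutionOfSingularities.ResolutionOfSingularities.Theorems.SpreadCut
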